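import Summits.AtomisticToContinuum.HydrodynamicLimit.Theorems.ImplosionDichotomyPolynomialCompressionExistenceReduced
import Summits.AtomisticToContinuum.HydrodynamicLimit.Theorems.ImplosionDichotomyHsEosLowDensity
import Literature.MathematicalPhysics.KineticTheory.HardSphereEulerLLN

/-!
# Fixed-horizon tracking of the ideal solution from local existence, continuation and an
# a-priori estimate (toward `ImplosionDichotomy.ImplosionUnboundedDensity`, stmt-12590)

Helper file for the route support `ImplosionUnboundedDensity` (stmt-AtomisticToContinuum-12590) of
the route `ImplosionDichotomy`. The glue file `…Theorems.ImplosionDichotomyImplosionUnboundedDensity`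
reduces that item (conditionally on the vendored implosion theorem
`Literature.Analysis.FluidPDE.CaolaboraEtAl2025_thm12_euler (5/3)`, with the statics discharged by the
tree) to the PURE PDE tracking statement with prescribed data — for continuous positive profiles
`(a₀, u₀, θ₀)`, a density field `ρ₁` and a time `T₁`:

  (TRACK) for every `0 < T₂ < T₁` and `ε > 0` there is `σ₀ > 0` such that for `0 < σ < σ₀` a
  classical hard-sphere-Euler solution `(ρ, u, θ)` on `[0, T)`, `T > T₂`, with data
  `(rhoLim (profileOf a₀) σ, u₀, θ₀)` exists and `|ρ t x - ρ₁ t x| < ε` for `t ∈ [0, T)`, `t ≤ T₂`.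

This file splits (TRACK) by provenance, in the style of the landed soft continuation lemma
`isHardSphereEulerSolution_exists_of_apriori_of_unique_data` and the landed small-packing
uniqueness theorem `hsEuler_unique_of_analytic_eos` (line `log-lipschitz-budget` of the crux
`PolynomialCompression`), the equation of state being the landed `hsEosLowDensity_proof`:

* (a) LOCAL EXISTENCE for the statics data at every small `σ` (Kato 1975 Thm II / Majda 1984
  Thm 2.1 for the symmetrisable `5 × 5` hard-sphere system; published input, not in the tree);
* (b) CONTINUATION: below some packing cap `η_b`, a classical solution on `[0, T)` obeying uniform
  state and `C¹` bounds extends to a strictly longer interval (Majda 1984 Thm 2.2; published input);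
* (c) the A-PRIORI TRACKING ESTIMATE on a fixed horizon `T' < T₁`: for every packing cap `η > 0`
  and `ε > 0` there are `σ₀ > 0` and `M > 0` such that for `0 < σ < σ₀` EVERY classical solution
  with the statics data on `[0, T)`, `T ≤ T'`, obeys the state/`C¹` bounds with constant `M`, has
  packing `≤ η`, and is `ε`-close to `ρ₁` in density (the `H³`-energy estimate for the difference
  with the smooth ideal solution, whose derivatives are bounded on `[0, T']`, plus a continuity
  argument — the one piece of new analysis; no log-Lipschitz budget is involved on a fixed horizon);

and proves `hsEuler_tracking_of_local_continuation_apriori : (a) → (b) → (c) → (TRACK)`: given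
`T₂ < T₁` and `ε`, work on the horizon `T' := (T₂ + T₁)/2` with the cap
`η := min η₁ η_b` (`η₁` the uniqueness threshold of `hsEuler_unique_of_analytic_eos`); (c) makes
the bounds an a-priori property of all solutions with the data on `[0, T)`, `T ≤ T'`, under which
two such solutions coincide (uniqueness at packing `≤ η₁`) and each extends (b); the soft lemma then
produces the solution on `[0, T')`, and (c) once more gives its `ε`-closeness on `[0, T₂] ⊆ [0, T')`.
-/

namespace Summit.AtomisticToContinuum.HydrodynamicLimit.Theorems

open Set MeasureTheory
open Literature.MathematicalPhysics.KineticTheory Literature.Analysis.FunctionSpaces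

/-- **Fixed-horizon tracking from local existence, continuation and an a-priori estimate.**
Let `(a₀, u₀, θ₀)` be continuous positive profiles, `ρ₁` a density field and `T₁` a time; write
`ρ₀^σ := rhoLim (profileOf a₀) σ` for the statics data. Assume (a) local existence: for
`0 < σ < σ_a` some classical hard-sphere-Euler solution with data `(ρ₀^σ, u₀, θ₀)` exists on some
`[0, T)`, `T > 0`; (b) continuation below a packing cap `η_b > 0`: for every `σ > 0`, `M > 0` and
`T > 0`, a classical solution on `[0, T)` with `M⁻¹ ≤ ρ, θ ≤ M`, `‖u‖ ≤ M`, `ρσ³ ≤ η_b` and all first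
space derivatives bounded by `M` on `[0, T) × 𝕋³` extends to a classical solution on a strictly
longer interval agreeing with it on `[0, T)`; (c) the a-priori tracking estimate: for every horizon
`0 < T' < T₁`, cap `η > 0` and `ε > 0` there are `σ₀ > 0`, `M > 0` such that for `0 < σ < σ₀` every
classical solution with the data `(ρ₀^σ, u₀, θ₀)` on `[0, T)`, `T ≤ T'`, obeys those bounds with
`(M, η)` and `|ρ t x - ρ₁ t x| < ε` on `[0, T) × 𝕋³`. Then (TRACK): for every `0 < T₂ < T₁` and
`ε > 0` there is `σ₀ > 0` such that for `0 < σ < σ₀` a classical solution with the data exists on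
some `[0, T)`, `T > T₂`, and is `ε`-close to `ρ₁` in density for `t ≤ T₂`. The equation of state
enters through the landed `hsEosLowDensity_proof` and `hsEuler_unique_of_analytic_eos` (uniqueness
at small packing), the gluing through `isHardSphereEulerSolution_exists_of_apriori_of_unique_data`.
[folklore] -/
theorem hsEuler_tracking_of_local_continuation_apriori {a₀ θ₀ : T3 → ℝ} {u₀ : T3 → V3}
    (ha : Continuous a₀) (ha0 : ∀ x, 0 < a₀ x) {T₁ : ℝ} {ρ₁ : ℝ → T3 → ℝ}
    (hloc : ∃ σa : ℝ, 0 < σa ∧ ∀ σ : ℝ, 0 < σ → σ < σa →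
      ∃ T : ℝ, 0 < T ∧ ∃ (ρ θ : ℝ → T3 → ℝ) (u : ℝ → T3 → V3),
        IsHardSphereEulerSolution σ T ρ u θ ∧ ρ 0 = rhoLim (profileOf a₀ ha ha0) σ ∧
        u 0 = u₀ ∧ θ 0 = θ₀)
    (hcont : ∃ ηb : ℝ, 0 < ηb ∧ ∀ σ : ℝ, 0 < σ → ∀ M : ℝ, 0 < M → ∀ T : ℝ, 0 < T →
      ∀ (ρ θ : ℝ → T3 → ℝ) (u : ℝ → T3 → V3), IsHardSphereEulerSolution σ T ρ u θ →
        (∀ t ∈ Ico 0 T, ∀ x,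
          M⁻¹ ≤ ρ t x ∧ ρ t x ≤ M ∧ M⁻¹ ≤ θ t x ∧ θ t x ≤ M ∧ ‖u t x‖ ≤ M ∧
          ρ t x * σ ^ 3 ≤ ηb ∧
          ∀ i : Fin 3, ‖Torus.partialDeriv i (u t) x‖ ≤ M ∧
            |Torus.partialDeriv i (ρ t) x| ≤ M ∧ |Torus.partialDeriv i (θ t) x| ≤ M) →
        ∃ T₂ : ℝ, T < T₂ ∧ ∃ (ρ' θ' : ℝ → T3 → ℝ) (u' : ℝ → T3 → V3),
          IsHardSphereEulerSolution σ T₂ ρ' u' θ' ∧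
          ∀ t ∈ Ico 0 T, ρ' t = ρ t ∧ u' t = u t ∧ θ' t = θ t)
    (hapriori : ∀ T' : ℝ, 0 < T' → T' < T₁ → ∀ η : ℝ, 0 < η → ∀ ε : ℝ, 0 < ε →
      ∃ σ₀ : ℝ, 0 < σ₀ ∧ ∃ M : ℝ, 0 < M ∧ ∀ σ : ℝ, 0 < σ → σ < σ₀ →
        ∀ T : ℝ, T ≤ T' → ∀ (ρ θ : ℝ → T3 → ℝ) (u : ℝ → T3 → V3),
          IsHardSphereEulerSolution σ T ρ u θ → ρ 0 = rhoLim (profileOf a₀ ha ha0) σ →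
          u 0 = u₀ → θ 0 = θ₀ →
          ∀ t ∈ Ico 0 T, ∀ x,
            (M⁻¹ ≤ ρ t x ∧ ρ t x ≤ M ∧ M⁻¹ ≤ θ t x ∧ θ t x ≤ M ∧ ‖u t x‖ ≤ M ∧
              ρ t x * σ ^ 3 ≤ η ∧
              ∀ i : Fin 3, ‖Torus.partialDeriv i (u t) x‖ ≤ M ∧
                |Torus.partialDeriv i (ρ t) x| ≤ M ∧ |Torus.partialDeriv i (θ t) x| ≤ M) ∧
            |ρ t x - ρ₁ t x| < ε) :
    ∀ T₂ : ℝ, 0 < T₂ → T₂ < T₁ → ∀ ε : ℝ, 0 < ε → ∃ σ₀ : ℝ, 0 < σ₀ ∧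
      ∀ σ : ℝ, 0 < σ → σ < σ₀ → ∃ (T : ℝ) (ρ θ : ℝ → T3 → ℝ) (u : ℝ → T3 → V3), T₂ < T ∧
        IsHardSphereEulerSolution σ T ρ u θ ∧
        ρ 0 = rhoLim (profileOf a₀ ha ha0) σ ∧ u 0 = u₀ ∧ θ 0 = θ₀ ∧
        ∀ t ∈ Ico 0 T, t ≤ T₂ → ∀ x, |ρ t x - ρ₁ t x| < ε := by
  intro T₂ hT₂0 hT₂1 ε hε
  classical
  -- the equation of state and uniqueness at small packing
  obtain ⟨η₀, hη₀, F, hF, hEq, -, -, -⟩ := hsEosLowDensity_proof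
  obtain ⟨η₁, hη₁, huniq⟩ := hsEuler_unique_of_analytic_eos η₀ hη₀ F hF hEq
  obtain ⟨σa, hσa, hloc⟩ := hloc
  obtain ⟨ηb, hηb, hcont⟩ := hcont
  -- the working horizon `T' ∈ (T₂, T₁)` and packing cap `η := min η₁ ηb`
  set T' : ℝ := (T₂ + T₁) / 2 with hT'
  have hT'0 : 0 < T' := by rw [hT']; linarith
  have hT'1 : T' < T₁ := by rw [hT']; linarith
  have hT₂T' : T₂ < T' := by rw [hT']; linarith
  set η : ℝ := min η₁ ηb with hη
  have hη0 : 0 < η := lt_min hη₁ hηb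
  obtain ⟨σ₀, hσ₀, M, hM, hbd⟩ := hapriori T' hT'0 hT'1 η hη0 ε hε
  refine ⟨min σ₀ σa, lt_min hσ₀ hσa, fun σ hσ hσlt => ?_⟩
  have hσσ₀ : σ < σ₀ := lt_of_lt_of_le hσlt (min_le_left _ _)
  have hσσa : σ < σa := lt_of_lt_of_le hσlt (min_le_right _ _)
  have hbdσ := hbd σ hσ hσσ₀
  -- uniqueness among solutions with the data on `[0, T)`, `T ≤ T'`: their packing is `≤ η ≤ η₁`
  have Huniq : ∀ T : ℝ, T ≤ T' → ∀ (ρa θa : ℝ → T3 → ℝ) (ua : ℝ → T3 → V3) (ρb θb : ℝ → T3 → ℝ)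
      (ub : ℝ → T3 → V3), IsHardSphereEulerSolution σ T ρa ua θa →
      IsHardSphereEulerSolution σ T ρb ub θb →
      ρa 0 = rhoLim (profileOf a₀ ha ha0) σ → ua 0 = u₀ → θa 0 = θ₀ →
      ρb 0 = rhoLim (profileOf a₀ ha ha0) σ → ub 0 = u₀ → θb 0 = θ₀ →
      ∀ t ∈ Ico 0 T, ρa t = ρb t ∧ ua t = ub t ∧ θa t = θb t := by
    intro T hT ρa θa ua ρb θb ub hsa hsb hρa hua hθa hρb hub hθb
    have hpa : ∀ t ∈ Ico 0 T, ∀ x, ρa t x * σ ^ 3 ≤ η₁ := fun t ht x =>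
      ((hbdσ T hT ρa θa ua hsa hρa hua hθa t ht x).1.2.2.2.2.2.1).trans (min_le_left _ _)
    have hpb : ∀ t ∈ Ico 0 T, ∀ x, ρb t x * σ ^ 3 ≤ η₁ := fun t ht x =>
      ((hbdσ T hT ρb θb ub hsb hρb hub hθb t ht x).1.2.2.2.2.2.1).trans (min_le_left _ _)
    exact huniq σ hσ T ρa θa ua ρb θb ub hsa hsb hpa hpb (hρa.trans hρb.symm)
      (hua.trans hub.symm) (hθa.trans hθb.symm)
  -- continuation: the a-priori bounds with cap `η ≤ ηb` feed (b)
  have Hcont : ∀ T : ℝ, 0 < T → T < T' → ∀ (ρ θ : ℝ → T3 → ℝ) (u : ℝ → T3 → V3),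
      IsHardSphereEulerSolution σ T ρ u θ → ρ 0 = rhoLim (profileOf a₀ ha ha0) σ → u 0 = u₀ →
      θ 0 = θ₀ →
      (∀ t ∈ Ico 0 T, ∀ x,
        (M⁻¹ ≤ ρ t x ∧ ρ t x ≤ M ∧ M⁻¹ ≤ θ t x ∧ θ t x ≤ M ∧ ‖u t x‖ ≤ M ∧
          ρ t x * σ ^ 3 ≤ η ∧
          ∀ i : Fin 3, ‖Torus.partialDeriv i (u t) x‖ ≤ M ∧
            |Torus.partialDeriv i (ρ t) x| ≤ M ∧ |Torus.partialDeriv i (θ t) x| ≤ M) ∧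
        |ρ t x - ρ₁ t x| < ε) →
      ∃ T₂ : ℝ, T < T₂ ∧ ∃ (ρ' θ' : ℝ → T3 → ℝ) (u' : ℝ → T3 → V3),
        IsHardSphereEulerSolution σ T₂ ρ' u' θ' ∧
        ∀ t ∈ Ico 0 T, ρ' t = ρ t ∧ u' t = u t ∧ θ' t = θ t := by
    intro T hT0 _ ρ θ u hs _ _ _ hP
    refine hcont σ hσ M hM T hT0 ρ θ u hs fun t ht x => ?_
    obtain ⟨⟨h1, h2, h3, h4, h5, h6, h7⟩, -⟩ := hP t ht x
    exact ⟨h1, h2, h3, h4, h5, h6.trans (min_le_right _ _), h7⟩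
  -- existence on `[0, T')` by the soft continuation lemma, with the a-priori predicate of (c)
  obtain ⟨ρ, θ, u, hsol, hρ0, hu0, hθ0⟩ :=
    isHardSphereEulerSolution_exists_of_apriori_of_unique_data (σ := σ)
      (ρ₀ := rhoLim (profileOf a₀ ha ha0) σ) (θ₀ := θ₀) (u₀ := u₀)
      (fun T ρ u θ => ∀ t ∈ Ico 0 T, ∀ x,
        (M⁻¹ ≤ ρ t x ∧ ρ t x ≤ M ∧ M⁻¹ ≤ θ t x ∧ θ t x ≤ M ∧ ‖u t x‖ ≤ M ∧
          ρ t x * σ ^ 3 ≤ η ∧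
          ∀ i : Fin 3, ‖Torus.partialDeriv i (u t) x‖ ≤ M ∧
            |Torus.partialDeriv i (ρ t) x| ≤ M ∧ |Torus.partialDeriv i (θ t) x| ≤ M) ∧
        |ρ t x - ρ₁ t x| < ε)
      hT'0 (hloc σ hσ hσσa) Huniq Hcont (fun T hT ρ θ u hs hρ hu hθ => hbdσ T hT ρ θ u hs hρ hu hθ)
  refine ⟨T', ρ, θ, u, hT₂T', hsol, hρ0, hu0, hθ0, fun t ht _ x => ?_⟩
  exact (hbdσ T' le_rfl ρ θ u hsol hρ0 hu0 hθ0 t ht x).2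

end Summit.AtomisticToContinuum.HydrodynamicLimit.Theorems
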